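import Mathlib
import Summits.PneNP.PneNP.Theses.OverlapGapAlgebra

/-!
# Route OverlapGapAlgebra — support item `CruxesImplyTarget` (stmt-PneNP-2466)

`Summit.PneNP.PneNP.Theses.OverlapGapAlgebra.CruxesImplyTarget :
  NoStableSection → SolvableImpliesStableSection → PositiveSatProbability → SearchHardWindow`.

Elementary glue. Take `k ≥ max(k₀, k₀', 3)` (the thresholds of `NoStableSection` and
`PositiveSatProbability`) and `α := 5·2^k·log k / k` (so `⌊α·n⌋₊` is syntactically the floor of the
two `k`-indexed hypotheses, and `α > 0` because `k ≥ 3`). The first conjunct of `SearchHardWindow`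
is `PositiveSatProbability` at `k`. For the second, fix a polynomial-time `f` and `ε > 0` and argue
by contradiction: if the success ratio of `f` is not eventually `≤ ε`, it is frequently `≥ ε`, so
`SolvableImpliesStableSection` (fed with the `η, ν` of `NoStableSection` and the rate `c/2`) gives,
frequently in `n`, a section `g` whose stable-path count is `≥ e^{-cn/2}·#Ψ`, while
`NoStableSection` bounds every section's count by `e^{-cn}·#Ψ` eventually; since `#Ψ > 0` for
`n ≥ 1` this forces `e^{-cn/2} ≤ e^{-cn}`, i.e. `c·n ≤ c·n/2`, impossible for `c > 0`, `n ≥ 1`.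

No literature fact is assumed (pure `Filter.Frequently` / `Real.exp` bookkeeping).
-/

namespace Summit.PneNP.PneNP.Theorems

set_option linter.dupNamespace false -- Summit.PneNP.PneNP: summit = sub-problem (D-0017)

open Summit.PneNP.PneNP.Theses.OverlapGapAlgebra
open Filter

/-- Cancellation step of the glue: for `c > 0`, `n ≥ 1` and a nonempty finite type `Ω`, no real `x`
satisfies `e^{-(c/2)·n}·|Ω| ≤ x ≤ e^{-c·n}·|Ω|`. -/
theorem overlapGap_exp_sandwich_false {c : ℝ} {n : ℕ} (hc : 0 < c) (hn : 1 ≤ n) {Ω : Type*}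
    [Fintype Ω] [Nonempty Ω] {x : ℝ}
    (h₁ : Real.exp (-(c / 2 * n)) * Fintype.card Ω ≤ x)
    (h₂ : x ≤ Real.exp (-(c * n)) * Fintype.card Ω) : False := by
  have hcard : (0 : ℝ) < Fintype.card Ω := by exact_mod_cast Fintype.card_pos
  have hle : Real.exp (-(c / 2 * n)) ≤ Real.exp (-(c * n)) :=
    le_of_mul_le_mul_right (h₁.trans h₂) hcard
  have hn' : (1 : ℝ) ≤ n := by exact_mod_cast hn
  have hcn : 0 < c * n := mul_pos hc (by linarith)
  have := Real.exp_le_exp.1 hle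
  linarith

/-- **Item `CruxesImplyTarget` (stmt-PneNP-2466)** of route OverlapGapAlgebra: the three cruxes
`NoStableSection`, `SolvableImpliesStableSection`, `PositiveSatProbability` imply the target
`SearchHardWindow`, at the witness `k := max (max k₀ k₀') 3`, `α := 5·2^k·log k/k`. -/
theorem cruxesImplyTarget_proof :
    Summit.PneNP.PneNP.Theses.OverlapGapAlgebra.CruxesImplyTarget := by
  unfold CruxesImplyTarget
  intro hNo hSolv hPos
  obtain ⟨k₀, hk₀⟩ := hNo
  obtain ⟨k₁, hk₁⟩ := hPos
  obtain ⟨k, hk0, hk1, hk3⟩ : ∃ k : ℕ, k₀ ≤ k ∧ k₁ ≤ k ∧ 3 ≤ k :=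
    ⟨max (max k₀ k₁) 3, le_trans (le_max_left _ _) (le_max_left _ _),
      le_trans (le_max_right _ _) (le_max_left _ _), le_max_right _ _⟩
  obtain ⟨η, hη, ν, hν, c, hc, hev⟩ := hk₀ k hk0
  obtain ⟨ε, hε, hsat⟩ := hk₁ k hk1
  refine ⟨k, 5 * 2 ^ k * Real.log k / k, ⟨ε, hε, hsat⟩, ?_⟩
  intro f hf ε' hε'
  by_contra hnot
  -- positivity of the density `α = 5·2^k·log k/k` (uses `k ≥ 3`)
  have hk1' : (1 : ℝ) < k := by exact_mod_cast (by omega : 1 < k)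
  have hkpos : (0 : ℝ) < k := by linarith
  have hlog : 0 < Real.log k := Real.log_pos hk1'
  have hα : (0 : ℝ) < 5 * 2 ^ k * Real.log k / k :=
    div_pos (mul_pos (mul_pos (by norm_num) (by positivity)) hlog) hkpos
  -- the transfer crux, fed with the frequent success of `f` and the rate `c/2`
  have key := hSolv k hk3 (5 * 2 ^ k * Real.log k / k) η ν hα hη hν
    ⟨f, hf, ε', hε', (Filter.not_eventually.1 hnot).mono fun n hn m hm => by
      by_contra hlt
      exact hn fun m' hm' => by subst hm'; subst hm; exact (not_le.1 hlt).le⟩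
    (c / 2) (half_pos hc)
  -- frequently (∃ stable section) ∧ eventually (no stable section) ∧ eventually (n ≥ 1) ⇒ False
  refine Filter.frequently_false (Filter.atTop : Filter ℕ)
    ((key.and_eventually (hev.and (Filter.eventually_ge_atTop 1))).mono ?_)
  rintro n ⟨h₁, h₂, hn1⟩
  obtain ⟨g, hg⟩ := h₁ _ rfl
  have hg' := h₂ _ rfl g
  haveI : NeZero n := ⟨Nat.one_le_iff_ne_zero.1 hn1⟩
  exact overlapGap_exp_sandwich_false hc hn1 hg hg'

end Summit.PneNP.PneNP.Theorems
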